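import Mathlib.Analysis.SpecialFunctions.Pow.Real
import Mathlib.Analysis.SpecialFunctions.Trigonometric.Inverse
import Literature.MathematicalPhysics.QuantumLattice.HubbardLuttingerLiquid1D
import HarnessLib

/-!
# Mastropietro (2005), *Rigorous proof of Luttinger liquid behavior in the 1d Hubbard model*:
# Theorem 1 (cite-only), Theorem 2 (magnetic field; typeable shadow), Theorem 4 / Lemmas 1–2 (flow)

Typer-wave file F8a of cell `gate-hubbard-kl` (D-0069 (2); DAG rows `Mas05.T1` (+ remark a)),
`Mas05.L1`, optional `Mas05.T2`, `Mas05.T3`, `Mas05.T4`, `Mas05.L2`–`Mas05.L6`), statements-first.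
ONE source: V. Mastropietro, J. Stat. Phys. 121 (2005) 373–432, doi:10.1007/s10955-005-7007-0,
arXiv:cond-mat/0502415 [Mastropietro2005], held as `paper:arxiv-cond-mat_0502415`; locators `p00NN:Lnn`
are chunk:line of that TeX render (20 chunks; NOT printed pages), TeX labels `\Eq(…)` quoted as printed.
Book form: [Mastropietro2008] Ch. 13, typed in the sibling file `FermiRG/Mastropietro2008Ch13.lean`
(Thm 1 = Thm 13.1, Thm 4 = Lemma 13.1, Lemma 1 = Lemma 13.2 — ONE declaration per statement, the flow
statements live there).  `d = 1` methodology only; nothing here concerns the 2D Hubbard model.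

## Source, quoted (render chunks)

* (1.2) `\equ(1)` p0003:L55–64: `H = -t Σ_{x∈Λ}Σ_σ (a⁺_{x,σ}a⁻_{x+1,σ} + a⁺_{x+1,σ}a⁻_{x,σ}) + U Σ_x
  a⁺_{x,+}a⁻_{x,+}a⁺_{x,-}a⁻_{x,-} - μ Σ_{x,σ} a⁺_{x,σ}a⁻_{x,σ}`, "t = 1/2 is the hopping parameter, U > 0
  the coupling"; `\equ(2)` p0003:L69–75: the generalisation `H = -(1/2)Σ(hopping) + U Σ_{x,y} v(x-y)
  a⁺_{x,+}a⁻_{x,+}a⁺_{y,-}a⁻_{y,-} - μN + h Σ_x (a⁺_{x,+}a⁻_{x,+} - a⁺_{x,-}a⁻_{x,-})` (short-range `v`, magnetic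
  field `h`); free propagator `\Eq(1.2a)` p0003:L115 `1/(-ik₀ + μ - cos k)`, `μ = cos p_F⁰`, `v₀ = sin p_F⁰`.
* **Theorem 1** `\sub(1.3)` p0004:L18–40 — typed as the landed named fact
  `Literature.MathematicalPhysics.QuantumLattice.mastropietro_1d_two_point_limit` (quoted in full in that
  module's docstring; `-1 < μ < 1`, `μ ≠ 0`, `∃ε > 0`, `0 < U < ε`; Luttinger form (1.3aa), `η = aU² +
  U²f₀(U)`, `a > 0`).  **Remark a)** p0004:L79–82: "A naive estimate of ε in the above Theorem is
  `ε = O(|μ|^α)` for some constant α, for μ close to 0; that is U must be taken smaller and smaller as we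
  are closer and closer to the half filled band case."
* **Theorem 2** `\sub(1.3a)` p0005:L51–72: "Consider the hamiltonian (2) with `-1 < μ < 1` and `0 ≤ h ≤ h₀`
  for a suitable constant `h₀`; assume also that `cos⁻¹(μ+h) + cos⁻¹(μ-h) ≠ π`.  There exists positive
  constants `ε₁, ε₂` (depending on μ and h, and `ε₂` vanishing as `h → 0`) such that, if `-ε₂ ≤ U ≤ ε₁` the
  two point Schwinger function is given by, in the limit `L, β → ∞`, (1.3aa1) `S_σ(x,y) = Σ_ω e^{iωp_F^σ(x-y)}
  /(v(x₀-y₀) + iω(x-y)) · (1 + A_ω(x,y))/|x-y|^η + S̄(x,y)` with `η = aU² + O(U³)`, `p_F^σ = cos⁻¹(μ +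
  sign(σ)h) + O(U)`, `v = sin(cos⁻¹(μ + sign(σ)h)) + O(U)`, where `a > 0` and [bounds (prop11)]."  p0005:L74–78:
  "the Hubbard model is still a Luttinger liquid even in presence of a magnetic field; this happens even in
  the attractive case, if the interaction is smaller than the magnetic field."  §8 p0019:L38–41: "we are
  assuming in Theorem 2 that `|cos⁻¹(μ+h) + cos⁻¹(μ-h) - π| ≥ C̄` …; this implies that the configuration
  `(ω,-ω,ω,-ω)` is not allowed."
* **Theorem 3** `(3.3hh)` p0008:L87–97: "Assume that `μ ≠ 0, ±1` and `sup_{k≥h}|v⃗_k| ≤ ε_h`; assume also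
  that, for some constant `c`, `sup_{k≥h} Z_k/Z_{k-1} ≤ e^{cε_h²}`; then there exists `ε̄` such that, for
  `ε_h ≤ ε̄` the functions `W^{(h)}_{2n,σ,ω}(x₁,…,x_n)` are analytic in the running coupling constants
  `(v⃗_k)_{k≥h}` and `∫dx₁..dx_n |W^{(h)}_{2n,σ,ω}| ≤ (C ε_h h̄^α)^{max(1,n/2)} Lβ γ^{(2-n)h}` `\Eq(xx)`."
* §4 p0010:L45–51, the flow equations `\Eq(b1)`–`\Eq(b4)`: `Z_{h-1}/Z_h = 1 + z_h(v_h,..,v_1)`,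
  `ν_{h-1} = γν_h + β_ν^{(h)}(v_h,..,v_1)`, `δ_{h-1} = δ_h + β_δ^{(h)}(v_h,..,v_1)`, `g_{i,h-1} = g_{i,h} +
  β_{g,i}^{(h)}(v_h,..,v_1)`; `\Eq(f1)` p0010:L97–104 the split flow (the `g₁` equation printed with TWO
  second-order constants, `-g_{1,h}[a₁g_{1,h} + a₂g_{1,h+1}]`, `a = a₁ + a₂` `\Eq(att)`).
* **Theorem 4** (Partial vanishing of the Beta function) p0011:L15–24 `\Eq(1a)`–`\Eq(1c)` = [Mastropietro2008,
  Lemma 13.1 (13.19)] verbatim.  **Lemma 1** p0011:L47–52 `\Eq(opp)` = [Mastropietro2008, Lemma 13.2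
  (13.20)] verbatim: "Assume that `|ν_h|, |δ_h| ≤ cUγ^{ϑh}` for any h.  For `U > 0` and small enough the flow
  is given by, for any h, `|g_{2,h} - g_{2,0} - g_{1,0}/2| ≤ U^{3/2}`, `|g_{4,h} - g_{4,0}| ≤ U^{3/2}`,
  `0 < g_{1,h} ≤ g_{1,0}/(1 - a/3 g_{1,0} h)`."
* **Lemma 2** `(4.4)` p0011:L151–154: "There exist sequences `ν = {ν_h}_{h≤1}`, `δ = {δ_h}_{h≤1}` such that
  `|ν_h| ≤ cUγ^{ϑh}`, `|δ_h| ≤ cUγ^{ϑh}`" — chosen (p0011:L143–150, p0012:L5–45) as the fixed point of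
  `\Eq(5.8c)`–`\Eq(5.8cs)` `T(ν)_h = -Σ_{k≤h} γ^{k-h-1} β^k_ν(g_k(δ,ν),ν_k;…)`, `T(δ)_h = -Σ_{k≤h} β^k_δ(…)`,
  i.e. solving `\Eq(b2)`–`\Eq(b3)` with `ν_{-∞} = δ_{-∞} = 0`, a contraction on `𝔐_ϑ` for U small.
* **Lemmas 3–6** (§5–§6, p0012:L153, p0013:L69, p0015:L98, p0017:L114): flow and Ward / correction
  identities of the REFERENCE MODEL `\equ(ll1)` used to prove Theorem 4 — NOT typed (its objects, a
  `g₂ᵒ, g₂ᵖ, g₄` model with linear dispersion and momentum cutoff, are absent from the tree).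

## Conventions (the factor-2 map; mandatory per cite item wi-67926)

The tree's `hubbardTorusWith 1 L 1 U μ` has hopping `1` (dispersion `-2cos k - μ`, band `[-2,2]`, half
filling `μ = 0`); (1)/(2) have `t = 1/2`.  `H_paper(μ_M, U_M, h_M) = ½·H_tree(μ, U, h)` with `μ = 2μ_M`,
`U = 2U_M` and Zeeman coefficient `h = 2h_M` (the term `h_M Σ_x(n_{x↑} - n_{x↓})` of (2) doubles with the
rest); `β` rescales by `2`, immaterial for `β → ∞`.  Hence `-1 < μ_M < 1 ↔ -2 < μ < 2`, `μ_M ≠ 0 ↔ μ ≠ 0`,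
`cos⁻¹(μ_M ± h_M) = cos⁻¹((μ ± h)/2)`, `0 < U_M < ε ↔ 0 < U < 2ε` (kernel-checked for Thm 1 / Thm 13.1 in
`FermiRG.Mastropietro2008.theorem13_1_shadow_iff`).  The paper measures `μ` so that `μ = cos p_F`
((1.2a): `μ → 1` is the EMPTY band); every regime typed here is symmetric under `μ ↦ -μ`, `h ↦ -h`
(particle–hole / spin flip), so this sign is immaterial and is not tracked.

## What is typed

* §A Theorem 1 — nothing new: the landed fact is cited (row `Mas05.T1` cite-only); remark a) is prose.
* §B Theorem 2 — the Hubbard chain in a magnetic field `hubbardZeemanTorus1D` (= (2) with LOCAL `v`,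
  tree conventions), its finite-volume two-point function, the NON-NESTING hypothesis shown to be exactly
  `μ ≠ 0` (`arccos_add_arccos_eq_pi_iff`, proved), and the NAMED FACT `theorem2_shadow` (typeable shadow:
  existence of the iterated limit `lim_β lim_L`, same shape as `mastropietro_1d_two_point_limit`; for
  `0 < h ≤ h₀` BOTH signs `-ε₂ ≤ U ≤ ε₁` — attractive allowed only under the field).
* §C Lemma 2 — as a predicate `Lemma2Statement` on abstract counterterm Beta functionals (no closed fact:
  the functionals `β_ν^{(h)}, β_δ^{(h)}` of the 1D Hubbard tree expansion are not tree objects; cell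
  GAP-LEDGER G-t8-1).
* Theorem 4 and Lemma 1 are the predicates `FermiRG.Mastropietro2008.BetaSplit.PartialVanishing` and
  `FermiRG.Mastropietro2008.Lemma13_2Statement` of the sibling file, with the flow arithmetic
  `\Eq(oppo)`–`\Eq(oppo3)` PROVED there (`g1_le_of_riccati_step`, `sum_geometric_div_le`,
  `sum_sq_riccati_le`); not re-declared here.  Theorem 3 is a statement about the multiscale kernels
  `W^{(h)}_{2n}` (same missing objects) and is not typed.

Nothing here asserts or denies anything about `d = 2`; `U > 0` (Thm 1, Lemma 1) and `μ ≠ 0` are kept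
exactly where printed; Theorem 2's attractive side exists only for `h > 0`.
-/

noncomputable section

open Finset Filter Topology Matrix
open Literature.Probability.LatticeModels

namespace Literature.MathematicalPhysics.QuantumLattice.FermiRG

namespace Mastropietro2005

/-! ## §A. Theorem 1 — cite-only

Row `Mas05.T1`: Theorem 1 is `Literature.MathematicalPhysics.QuantumLattice.mastropietro_1d_two_point_limit`
(`HubbardLuttingerLiquid1D.lean`, cite item wi-67926), equivalent to its book-parameter restatement by
`FermiRG.Mastropietro2008.theorem13_1_shadow_iff`.  No declaration is added for it here. -/

/-! ## §B. Theorem 2 — the Hubbard chain in a magnetic field -/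

/-- `Mas05.T2` · **Hamiltonian (2) with local interaction and magnetic field, tree conventions**: the
Hubbard chain `hubbardTorusWith 1 L 1 U μ` (hopping `1`) on the ring `ℤ/Lℤ` plus the Zeeman term
`h Σ_x (n_{x↑} - n_{x↓})` (spin `0 = ↑ = +`, `1 = ↓ = -`); `= ½`-rescaled paper Hamiltonian at `μ_M = μ/2`,
`U_M = U/2`, `h_M = h/2`.  The paper's (2) allows a short-range `U v(x-y)`; only the Hubbard case `v = δ` is
typed. [cite: Mastropietro2005, §1.2 eq. (2) (p0003:L69)] -/
def hubbardZeemanTorus1D (L : ℕ) (U μ h : ℝ) :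
    Matrix (Finset (Orb (FermionTorus 1 L))) (Finset (Orb (FermionTorus 1 L))) ℂ :=
  hubbardTorusWith 1 L 1 U μ + (h : ℂ) • ∑ x : FermionTorus 1 L, (numberOp x 0 - numberOp x 1)
-- TODO(general form): the `U-V` / short-range `v(x-y)` interaction of (2) is not in the tree.

/-- At zero field (2) (local case) is the Hubbard chain (1). [cite: Mastropietro2005, §1.2 eqs. (1)-(2) (p0003:L55-75)] -/
@[simp] theorem hubbardZeemanTorus1D_zero_field (L : ℕ) (U μ : ℝ) :
    hubbardZeemanTorus1D L U μ 0 = hubbardTorusWith 1 L 1 U μ := by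
  simp [hubbardZeemanTorus1D]

/-- The Zeeman term is `2h S^z` with the tree's `S^z = ½ Σ_x (n_{x↑} - n_{x↓})`.
[cite: Mastropietro2005, §1.2 eq. (2) (p0003:L75)] -/
theorem hubbardZeemanTorus1D_eq_spinZ (L : ℕ) (U μ h : ℝ) :
    hubbardZeemanTorus1D L U μ h = hubbardTorusWith 1 L 1 U μ + (2 * (h : ℂ)) • HubbardWave0.spinZ := by
  unfold hubbardZeemanTorus1D HubbardWave0.spinZ
  rw [smul_smul]
  congr 2
  ring

/-- `Mas05.T2` · The finite-volume thermal (equal-time) two-point function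
`<a⁺_{x,σ} a⁻_{y,σ}>_{L,β}` of the Hubbard chain in a magnetic field (spin-resolved: Theorem 2's `S_σ`),
sites `x, y ∈ ℤ` projected to the ring `ℤ/Lℤ`, junk `0` at `L = 0` — the pattern of
`hubbardThermalTwoPoint1D`. [cite: Mastropietro2005, §1.2 (sf11) and §(1.aa2) (p0003:L101, p0005:L47)] -/
def hubbardZeemanThermalTwoPoint1D (β U μ h : ℝ) (L : ℕ) (x y : Site 1) (σ : Fin 2) : ℂ :=
  if hL : L = 0 then 0
  else
    haveI : NeZero L := ⟨hL⟩
    thermalCorr β (hubbardZeemanTorus1D L U μ h)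
      (creation (orb (FermionTorus.ofTorusSite (Torus.proj L x)) σ))
      (annihilation (orb (FermionTorus.ofTorusSite (Torus.proj L y)) σ))

/-- Junk value at `L = 0`. [cite: Mastropietro2005, §1.2 (sf11) (p0003:L101)] -/
@[simp] theorem hubbardZeemanThermalTwoPoint1D_zero (β U μ h : ℝ) (x y : Site 1) (σ : Fin 2) :
    hubbardZeemanThermalTwoPoint1D β U μ h 0 x y σ = 0 := by
  simp [hubbardZeemanThermalTwoPoint1D]

/-- At zero field the spin-resolved two-point function is the one of Theorem 1's shadow
(`hubbardThermalTwoPoint1D`, same spin on both legs). [cite: Mastropietro2005, §1.2 (sf11) (p0003:L101)] -/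
theorem hubbardZeemanThermalTwoPoint1D_zero_field (β U μ : ℝ) (L : ℕ) (x y : Site 1) (σ : Fin 2) :
    hubbardZeemanThermalTwoPoint1D β U μ 0 L x y σ = hubbardThermalTwoPoint1D β U μ L x y σ σ := by
  by_cases hL : L = 0
  · subst hL; simp
  · simp [hubbardZeemanThermalTwoPoint1D, hubbardThermalTwoPoint1D_of_ne_zero β U μ hL, hL]

/-- `Mas05.T2` (hypothesis) · **The non-nesting condition of Theorem 2 is exactly «not half filled»**:
for `a, b ∈ [-1, 1]`, `cos⁻¹ a + cos⁻¹ b = π ↔ b = -a`; hence with `a = μ_M + h_M`, `b = μ_M - h_M` the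
printed hypothesis `cos⁻¹(μ+h) + cos⁻¹(μ-h) ≠ π` says `p_F^↑ + p_F^↓ ≠ π`, i.e. `μ_M ≠ 0` (it forbids the
umklapp configuration `(ω,-ω,ω,-ω)`, §8 p0019:L38–41). [cite: Mastropietro2005, Thm 2 (p0005:L53) and §8 (p0019:L38)] -/
theorem arccos_add_arccos_eq_pi_iff {a b : ℝ} (ha₁ : -1 ≤ a) (ha₂ : a ≤ 1) (hb₁ : -1 ≤ b) (hb₂ : b ≤ 1) :
    Real.arccos a + Real.arccos b = Real.pi ↔ b = -a := by
  constructor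
  · intro h
    have h1 : Real.arccos b = Real.arccos (-a) := by
      rw [Real.arccos_neg]; linarith
    exact (Real.arccos_inj hb₁ hb₂ (by linarith) (by linarith)).1 h1
  · intro h
    rw [h, Real.arccos_neg]
    ring

/-- `Mas05.T2` (hypothesis, tree form) · In tree parameters (`μ = 2μ_M`, `h = 2h_M`, `|μ ± h| ≤ 2`) the
non-nesting hypothesis `cos⁻¹((μ+h)/2) + cos⁻¹((μ-h)/2) ≠ π` is `μ ≠ 0`.
[cite: Mastropietro2005, Thm 2 (p0005:L53)] -/
theorem nonNesting_iff_ne_zero {μ h : ℝ} (h₁ : -2 ≤ μ + h) (h₂ : μ + h ≤ 2) (h₃ : -2 ≤ μ - h)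
    (h₄ : μ - h ≤ 2) :
    Real.arccos ((μ + h) / 2) + Real.arccos ((μ - h) / 2) ≠ Real.pi ↔ μ ≠ 0 := by
  rw [not_iff_not.symm, not_not, not_not,
    arccos_add_arccos_eq_pi_iff (by linarith) (by linarith) (by linarith) (by linarith)]
  constructor
  · intro h0; linarith
  · intro h0; rw [h0]; ring

/-- `Mas05.T2` · **Mastropietro 2005, Theorem 2 — typeable shadow, NAMED FACT** (cell licence F-102).  In
tree conventions (hopping `1`; `μ = 2μ_M`, field `h = 2h_M`, `U = 2U_M`): for every `-2 < μ < 2` there is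
`h₀ > 0` such that for every field `0 < h ≤ h₀` with the non-nesting condition `cos⁻¹((μ+h)/2) +
cos⁻¹((μ-h)/2) ≠ π` (⟺ `μ ≠ 0`, `nonNesting_iff_ne_zero`) there are `ε₁, ε₂ > 0` (depending on `μ, h`)
such that for EVERY coupling `-ε₂ ≤ U ≤ ε₁` — attractive included — and all sites `x, y`, spin `σ`, the
spin-`σ` two-point functions `<a⁺_{x,σ}a⁻_{y,σ}>_{L,β}` of `hubbardZeemanTorus1D L U μ h` have limits
`S_β` as `L → ∞` for all large `β`, and `S_β → S` as `β → ∞` (the iterated limit `lim_β lim_L`, read as in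
the landed Thm-1 shadow [cite: BenfattoFalcoMastropietro2014, (1.12)]).  Printed for `0 ≤ h ≤ h₀` with
"`ε₂` vanishing as `h → 0`": the field-free attractive side is EMPTY, and `h = 0`, `0 < U` is Theorem 1, so
only `h > 0` is asserted here; the Luttinger form (1.3aa1) with the two Fermi momenta `p_F^σ = cos⁻¹(μ_M +
sign(σ)h_M) + O(U)` and `η = aU² + O(U³)` is prose only (no infinite-volume Schwinger functions in the
tree); local interaction only (the paper's (2) has a short-range `v`).
[cite: Mastropietro2005, Thm 2 (1.3aa1) (p0005:L51-72)] -/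
def theorem2_shadow : Prop :=
  ∀ μ : ℝ, -2 < μ → μ < 2 → ∃ h₀ : ℝ, 0 < h₀ ∧
    ∀ h : ℝ, 0 < h → h ≤ h₀ →
      Real.arccos ((μ + h) / 2) + Real.arccos ((μ - h) / 2) ≠ Real.pi →
        ∃ ε₁ ε₂ : ℝ, 0 < ε₁ ∧ 0 < ε₂ ∧
          ∀ U : ℝ, -ε₂ ≤ U → U ≤ ε₁ →
            ∀ (x y : Site 1) (σ : Fin 2), ∃ (Sβ : ℝ → ℂ) (S : ℂ),
              (∀ᶠ β in atTop,
                Tendsto (fun L : ℕ => hubbardZeemanThermalTwoPoint1D β U μ h L x y σ) atTop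
                  (𝓝 (Sβ β))) ∧
              Tendsto Sβ atTop (𝓝 S)

/-- The hypotheses of `theorem2_shadow` are jointly satisfiable away from half filling: e.g. `μ = 1`
(`μ_M = 1/2`), any `0 < h ≤ 1`. [cite: Mastropietro2005, Thm 2 (p0005:L51)] -/
theorem theorem2_shadow_hypotheses_nonvacuous {h : ℝ} (hh : 0 < h) (hh1 : h ≤ 1) :
    (-2 : ℝ) < 1 ∧ (1 : ℝ) < 2 ∧
      Real.arccos ((1 + h) / 2) + Real.arccos ((1 - h) / 2) ≠ Real.pi := by
  refine ⟨by norm_num, by norm_num, ?_⟩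
  rw [nonNesting_iff_ne_zero (by linarith) (by linarith) (by linarith) (by linarith)]
  norm_num

/-! ## §C. Lemma 2 — the counterterm sequences, as a predicate -/

/-- `Mas05.L2` · **Lemma 2 as a typed statement about abstract counterterm Beta functionals.**  Data: the
functionals `βν h`, `βδ h` of (b2)–(b3) evaluated along the flow — as functions of the whole pair of
sequences `(ν, δ)` (the quartic couplings `g_k = g_k(ν, δ)` being solved for parametrically, Lemma 1) —
the scaling parameter `γ > 1`, `0 < ϑ < 1`, the constant `c` and the coupling `U`.  Statement: there are
sequences `ν = {ν_h}_{h≤1}`, `δ = {δ_h}_{h≤1}` with `|ν_h|, |δ_h| ≤ cUγ^{ϑh}` solving `ν_{h-1} = γν_h +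
β_ν^{(h)}`, `δ_{h-1} = δ_h + β_δ^{(h)}` for all `h ≤ 1` (the fixed point of (5.8c)–(5.8cs)).  The printed
Lemma 2 is this predicate AT the Beta functionals of the 1D Hubbard model, which the tree lacks (cell
GAP-LEDGER G-t8-1) — a predicate, not a closed named fact.
[cite: Mastropietro2005, Lemma 2 (p0011:L151) with (b2)-(b3) (p0010:L47-49) and (5.8c)-(5.8cs) (p0012:L30-36)] -/
def Lemma2Statement (βν βδ : ℤ → (ℤ → ℝ) → (ℤ → ℝ) → ℝ) (c U γ θ : ℝ) : Prop :=
  ∃ ν δ : ℤ → ℝ,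
    (∀ h : ℤ, h ≤ 1 → |ν h| ≤ c * U * γ ^ (θ * (h : ℝ)) ∧ |δ h| ≤ c * U * γ ^ (θ * (h : ℝ))) ∧
    (∀ h : ℤ, h ≤ 1 → ν (h - 1) = γ * ν h + βν h ν δ ∧ δ (h - 1) = δ h + βδ h ν δ)

/-- Sanity of the shape: with vanishing Beta functionals the zero sequences witness `Lemma2Statement`
(for `c U ≥ 0`, `γ > 0`). [cite: Mastropietro2005, Lemma 2 (p0011:L151)] -/
theorem lemma2Statement_zero {c U γ θ : ℝ} (hcU : 0 ≤ c * U) (hγ : 0 < γ) :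
    Lemma2Statement (fun _ _ _ => 0) (fun _ _ _ => 0) c U γ θ := by
  refine ⟨fun _ => 0, fun _ => 0, fun h _ => ?_, fun h _ => ?_⟩
  · have : 0 ≤ c * U * γ ^ (θ * (h : ℝ)) := mul_nonneg hcU (Real.rpow_nonneg hγ.le _)
    simpa using this
  · simp

end Mastropietro2005

end Literature.MathematicalPhysics.QuantumLattice.FermiRG
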